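import Summits.Ventures.HodgeRepro2.T5ProductIsotypic
import Summits.Ventures.HodgeRepro2.T5IsotypicHom
import Mathlib.RepresentationTheory.AlgebraRepresentation.Basic
import Mathlib.LinearAlgebra.Dimension.Constructions
import Mathlib.LinearAlgebra.FiniteDimensional.Basic
import Mathlib.LinearAlgebra.Basis.VectorSpace

/-!
# An irreducible representation of `G₁ × G₂` is an external tensor product `σ ⊠ ρ₂`

Kernel witness (cell pub-hodge-repro2, seat p5, Tier 5) for the sentence of
route/T5-N4-p5.md v12 (A3) STEP 6 (l. 147)

> «An irreducible finite-dimensional representation ρ of K = K_∞ × K_f^{max} is ρ_∞ ⊗ ρ_f»,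

in its algebraic form, over an algebraically closed field `k`: if `ρ` is an irreducible
finite-dimensional representation of `G₁ × G₂` on `V` and `S` is a simple `k[G₁]`-submodule of `V`
(one exists: `T5ProductIsotypic.exists_isSimpleModule`), then

* `V|_{G₁}` is `S`-isotypic and semisimple (`T5ProductIsotypic`, own file p399071),
* `End_{k[G₁]}(S) = k` (Schur, Mathlib `IsSimpleModule.algebraMap_end_bijective_of_isAlgClosed`),
* hence the evaluation map `S ⊗[k] Hom_{k[G₁]}(S, V) → V` is a `k[G₁]`-linear isomorphism
  (p8's `T5IsotypicHom.evEquiv`, the kernel form of MVW Lemma III.3 — imported, not restated),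
* `G₂` acts on the multiplicity space `Hom_{k[G₁]}(S, V)` by post-composition with `ρ(1, g₂)`
  (`mult`), the isomorphism intertwines `ρ` with the external tensor product
  (`multTensorEquiv_map`: `Φ ((g₁ • ·) ⊗ mult g₂) = ρ (g₁, g₂) ∘ Φ`), and
* the multiplicity representation `mult ρ S` of `G₂` is IRREDUCIBLE (`mult_isIrreducible`): a
  `G₂`-stable subspace `U` of the multiplicity space gives the `(G₁ × G₂)`-stable subspace
  `Φ(S ⊗ U)` of `V`, which is `⊥` or `⊤`, and a dimension count (`finrank (S ⊗ U) = finrank S ·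
  finrank U`) forces `U = ⊥` or `U = ⊤`.

So `ρ ≅ σ_S ⊠ mult ρ S` with both factors irreducible — the algebraic content of the sentence; the
compactness of `K`, the unitarity of `ρ` and the identification `K = K_∞ × K_f^{max}` stay prose
in (A3) STEP 6.  Mathlib + the cell's own T5ProductIsotypic and p8's T5IsotypicHom.
-/

open scoped MonoidAlgebra TensorProduct
open Summit.Ventures.HodgeRepro2.T5ProductIsotypic
open Summit.Ventures.HodgeRepro2.T5IsotypicHom (postcomp postcomp_apply evEquiv evEquiv_tmul
  evEquiv_postcomp)

namespace Summit.Ventures.HodgeRepro2.T5ProductTensor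

variable {k G₁ G₂ V : Type*} [Field k] [Monoid G₁] [Monoid G₂] [AddCommGroup V] [Module k V]
variable (ρ : Representation k (G₁ × G₂) V)

/-- The multiplicity space of a simple `k[G₁]`-submodule `S` of `V`: `Hom_{k[G₁]}(S, V)`. -/
abbrev Mult (S : Submodule k[G₁] (restrictFst ρ).asModule) : Type _ :=
  S →ₗ[k[G₁]] (restrictFst ρ).asModule

/-- `G₂` acts on the multiplicity space by post-composition with `ρ (1, g₂)`. -/
noncomputable def mult (S : Submodule k[G₁] (restrictFst ρ).asModule) :
    Representation k G₂ (Mult ρ S) where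
  toFun g₂ := postcomp k k[G₁] S (restrictFst ρ).asModule (rightActionₗ ρ g₂)
  map_one' := by
    ext f n
    rw [postcomp_apply, rightActionₗ_apply, Prod.mk_one_one, map_one, Module.End.one_apply,
      Module.End.one_apply]
  map_mul' g h := by
    ext f n
    rw [Module.End.mul_apply, postcomp_apply, postcomp_apply, postcomp_apply, rightActionₗ_apply,
      rightActionₗ_apply, rightActionₗ_apply, ← Module.End.mul_apply, ← map_mul, Prod.mk_mul_mk,
      one_mul]

/-- `mult ρ S g₂ f = ρ (1, g₂) ∘ f`, pointwise. -/
theorem mult_apply (S : Submodule k[G₁] (restrictFst ρ).asModule) (g₂ : G₂) (f : Mult ρ S)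
    (n : S) : mult ρ S g₂ f n = ρ (1, g₂) (f n) := by
  rw [mult]
  exact postcomp_apply k k[G₁] S (restrictFst ρ).asModule (rightActionₗ ρ g₂) f n

/-- The action of `g₁ ∈ G₁` on the `k[G₁]`-submodule `S`, as a `k`-linear map. -/
noncomputable def sAct (S : Submodule k[G₁] (restrictFst ρ).asModule) (g₁ : G₁) : S →ₗ[k] S where
  toFun x := (MonoidAlgebra.single g₁ (1 : k)) • x
  map_add' x y := smul_add _ x y
  map_smul' c x := smul_comm _ c x

/-- `sAct ρ S g₁ x = ρ (g₁, 1) x` (as elements of `V`). -/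
theorem coe_sAct_apply (S : Submodule k[G₁] (restrictFst ρ).asModule) (g₁ : G₁) (x : S) :
    ((sAct ρ S g₁ x : S) : (restrictFst ρ).asModule) =
      restrictFst ρ g₁ (x : (restrictFst ρ).asModule) := by
  change ((MonoidAlgebra.single g₁ (1 : k)) • (x : (restrictFst ρ).asModule)) = _
  rw [Representation.single_smul, one_smul]
  rfl

section Schur

variable [IsAlgClosed k] [Module.Finite k V]

omit [IsAlgClosed k] in
/-- `S` is finite-dimensional over `k`. -/
theorem finite_submodule (S : Submodule k[G₁] (restrictFst ρ).asModule) : Module.Finite k S :=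
  Module.Finite.of_injective (S.subtype.restrictScalars k) Subtype.val_injective

/-- Schur: every `k[G₁]`-endomorphism of a simple finite-dimensional `S` is a scalar. -/
theorem schur (S : Submodule k[G₁] (restrictFst ρ).asModule) [IsSimpleModule k[G₁] S] :
    ∀ φ : S →ₗ[k[G₁]] S, ∃ c : k, ∀ x, φ x = c • x := by
  haveI := finite_submodule ρ S
  haveI : Nontrivial S := IsSimpleModule.nontrivial k[G₁] S
  intro φ
  obtain ⟨c, hc⟩ :=
    (IsSimpleModule.algebraMap_end_bijective_of_isAlgClosed (A := k[G₁]) (V := S) k).2 φ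
  exact ⟨c, fun x => by rw [← hc, Module.algebraMap_end_apply]⟩

variable [ρ.IsIrreducible]

/-- THE TENSOR DECOMPOSITION: `S ⊗[k] Hom_{k[G₁]}(S, V) ≃ₗ[k[G₁]] V`, `s ⊗ f ↦ f s`
(p8's `evEquiv`, fed with Schur and the isotypy/semisimplicity of `V|_{G₁}`). -/
noncomputable def multTensorEquiv (S : Submodule k[G₁] (restrictFst ρ).asModule)
    [IsSimpleModule k[G₁] S] : S ⊗[k] Mult ρ S ≃ₗ[k[G₁]] (restrictFst ρ).asModule :=
  haveI := isSemisimpleModule ρ S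
  haveI : Nontrivial S := IsSimpleModule.nontrivial k[G₁] S
  evEquiv (schur ρ S) (isIsotypicOfType ρ S)

/-- `multTensorEquiv ρ S (s ⊗ f) = f s`. -/
theorem multTensorEquiv_tmul (S : Submodule k[G₁] (restrictFst ρ).asModule) [IsSimpleModule k[G₁] S]
    (s : S) (f : Mult ρ S) : multTensorEquiv ρ S (s ⊗ₜ[k] f) = f s := by
  haveI := isSemisimpleModule ρ S
  haveI : Nontrivial S := IsSimpleModule.nontrivial k[G₁] S
  exact evEquiv_tmul (schur ρ S) (isIsotypicOfType ρ S) s f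

/-- Equivariance for `G₂`: `multTensorEquiv` intertwines `1 ⊗ mult g₂` with `ρ (1, g₂)`. -/
theorem multTensorEquiv_map_mult (S : Submodule k[G₁] (restrictFst ρ).asModule)
    [IsSimpleModule k[G₁] S] (g₂ : G₂) (x : S ⊗[k] Mult ρ S) :
    multTensorEquiv ρ S (TensorProduct.map LinearMap.id (mult ρ S g₂) x) =
      ρ (1, g₂) (multTensorEquiv ρ S x) := by
  haveI := isSemisimpleModule ρ S
  haveI : Nontrivial S := IsSimpleModule.nontrivial k[G₁] S
  exact evEquiv_postcomp (schur ρ S) (isIsotypicOfType ρ S) (fun g => rightActionₗ ρ g) g₂ x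

omit [IsAlgClosed k] [Module.Finite k V] [ρ.IsIrreducible] in
/-- `(g₁ • ·) ⊗ 1` on `S ⊗ Mult` is the `k[G₁]`-scalar action of `single g₁ 1`. -/
theorem map_sAct_id (S : Submodule k[G₁] (restrictFst ρ).asModule) (g₁ : G₁)
    (x : S ⊗[k] Mult ρ S) :
    TensorProduct.map (sAct ρ S g₁) LinearMap.id x = (MonoidAlgebra.single g₁ (1 : k)) • x := by
  induction x using TensorProduct.induction_on with
  | zero => simp only [map_zero, smul_zero]
  | tmul s f => rw [TensorProduct.map_tmul, LinearMap.id_apply, TensorProduct.smul_tmul']; rfl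
  | add x y hx hy => rw [map_add, hx, hy, smul_add]

/-- Equivariance for `G₁`: `multTensorEquiv` intertwines `sAct g₁ ⊗ 1` with `ρ (g₁, 1)`. -/
theorem multTensorEquiv_map_sAct (S : Submodule k[G₁] (restrictFst ρ).asModule)
    [IsSimpleModule k[G₁] S] (g₁ : G₁) (x : S ⊗[k] Mult ρ S) :
    multTensorEquiv ρ S (TensorProduct.map (sAct ρ S g₁) LinearMap.id x) =
      ρ (g₁, 1) (multTensorEquiv ρ S x) := by
  rw [map_sAct_id, map_smul, Representation.single_smul, one_smul]
  rfl

/-- FULL EQUIVARIANCE: `multTensorEquiv` intertwines the external tensor product `sAct g₁ ⊗ mult g₂`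
with `ρ (g₁, g₂)` — i.e. `ρ ≅ σ_S ⊠ mult ρ S`. -/
theorem multTensorEquiv_map (S : Submodule k[G₁] (restrictFst ρ).asModule) [IsSimpleModule k[G₁] S]
    (g₁ : G₁) (g₂ : G₂) (x : S ⊗[k] Mult ρ S) :
    multTensorEquiv ρ S (TensorProduct.map (sAct ρ S g₁) (mult ρ S g₂) x) =
      ρ (g₁, g₂) (multTensorEquiv ρ S x) := by
  have h : TensorProduct.map (sAct ρ S g₁) (mult ρ S g₂) =
      (TensorProduct.map (sAct ρ S g₁) LinearMap.id).comp
        (TensorProduct.map LinearMap.id (mult ρ S g₂)) := by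
    rw [← TensorProduct.map_comp, LinearMap.comp_id, LinearMap.id_comp]
  rw [h, LinearMap.comp_apply, multTensorEquiv_map_sAct, multTensorEquiv_map_mult, ← Module.End.mul_apply,
    ← map_mul, Prod.mk_mul_mk, mul_one, one_mul]

end Schur

/-! ### Irreducibility of the multiplicity representation -/

section Irreducible

variable [IsAlgClosed k] [Module.Finite k V] [ρ.IsIrreducible]
variable (S : Submodule k[G₁] (restrictFst ρ).asModule) [IsSimpleModule k[G₁] S]

omit [IsAlgClosed k] [ρ.IsIrreducible] [IsSimpleModule k[G₁] S] in
/-- The multiplicity space is finite-dimensional over `k`. -/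
theorem finite_mult : Module.Finite k (Mult ρ S) := by
  haveI := finite_submodule ρ S
  exact Module.Finite.of_injective (LinearMap.restrictScalarsₗ k k[G₁] S (restrictFst ρ).asModule k)
    (LinearMap.restrictScalars_injective k)

/-- The `k[G₁]`-submodule `Φ(S ⊗ U)` of `V` carried by a subspace `U` of the multiplicity
space. -/
noncomputable def carried (U : Submodule k (Mult ρ S)) : Submodule k[G₁] (restrictFst ρ).asModule :=
  (LinearMap.range (TensorProduct.AlgebraTensorModule.map (LinearMap.id : S →ₗ[k[G₁]] S)
    U.subtype)).map (multTensorEquiv ρ S).toLinearMap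

omit [IsAlgClosed k] [Module.Finite k V] [ρ.IsIrreducible] [IsSimpleModule k[G₁] S] in
/-- `AlgebraTensorModule.map id U.subtype` agrees with `lTensor S U.subtype`. -/
theorem algebraTensorModule_map_eq (U : Submodule k (Mult ρ S)) (z : S ⊗[k] U) :
    TensorProduct.AlgebraTensorModule.map (LinearMap.id : S →ₗ[k[G₁]] S) U.subtype z =
      U.subtype.lTensor S z := by
  induction z using TensorProduct.induction_on with
  | zero => simp only [map_zero]
  | tmul s u => rw [TensorProduct.AlgebraTensorModule.map_tmul, LinearMap.lTensor_tmul]; rfl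
  | add x y hx hy => rw [map_add, map_add, hx, hy]

omit [IsAlgClosed k] [Module.Finite k V] [ρ.IsIrreducible] [IsSimpleModule k[G₁] S] in
/-- `1 ⊗ mult g₂` carries `S ⊗ U` into itself when `U` is `mult`-stable. -/
theorem map_id_mult_mem_range (U : Submodule k (Mult ρ S))
    (hU : ∀ g₂ : G₂, ∀ f ∈ U, mult ρ S g₂ f ∈ U) (g₂ : G₂) (z : S ⊗[k] U) :
    TensorProduct.map LinearMap.id (mult ρ S g₂)
      (TensorProduct.AlgebraTensorModule.map (LinearMap.id : S →ₗ[k[G₁]] S) U.subtype z) ∈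
      LinearMap.range (TensorProduct.AlgebraTensorModule.map (LinearMap.id : S →ₗ[k[G₁]] S)
        U.subtype) := by
  refine ⟨TensorProduct.map LinearMap.id ((mult ρ S g₂).restrict (hU g₂)) z, ?_⟩
  induction z using TensorProduct.induction_on with
  | zero => simp only [map_zero]
  | tmul s u =>
    rw [TensorProduct.map_tmul, TensorProduct.AlgebraTensorModule.map_tmul,
      TensorProduct.AlgebraTensorModule.map_tmul, TensorProduct.map_tmul]
    rfl
  | add x y hx hy => rw [map_add, map_add, map_add, map_add, hx, hy]

/-- `carried U` is stable under every `ρ (1, g₂)` when `U` is `mult`-stable. -/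
theorem carried_stable (U : Submodule k (Mult ρ S))
    (hU : ∀ g₂ : G₂, ∀ f ∈ U, mult ρ S g₂ f ∈ U) (g₂ : G₂) (v : (restrictFst ρ).asModule)
    (hv : v ∈ carried ρ S U) : ρ (1, g₂) v ∈ carried ρ S U := by
  obtain ⟨y, ⟨z, rfl⟩, rfl⟩ := hv
  refine ⟨TensorProduct.map LinearMap.id (mult ρ S g₂)
    (TensorProduct.AlgebraTensorModule.map (LinearMap.id : S →ₗ[k[G₁]] S) U.subtype z),
    map_id_mult_mem_range ρ S U hU g₂ z, ?_⟩
  exact multTensorEquiv_map_mult ρ S g₂ _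

/-- `carried U` is a subrepresentation of `ρ`, hence `⊥` or `⊤`. -/
theorem carried_eq_bot_or_eq_top (U : Submodule k (Mult ρ S))
    (hU : ∀ g₂ : G₂, ∀ f ∈ U, mult ρ S g₂ f ∈ U) :
    carried ρ S U = ⊥ ∨ carried ρ S U = ⊤ := by
  rcases eq_bot_or_eq_top ρ (subrepresentationOfStable ρ (carried ρ S U) (carried_stable ρ S U hU))
    with h | h
  · left
    rw [eq_bot_iff]
    intro x hx
    have hx' : x ∈ subrepresentationOfStable ρ (carried ρ S U) (carried_stable ρ S U hU) :=
      (mem_subrepresentationOfStable ρ _ _ x).mpr hx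
    rw [h] at hx'
    exact (Submodule.mem_bot k[G₁]).mpr ((Submodule.mem_bot k).mp hx')
  · right
    rw [eq_top_iff]
    intro x _
    have hx' : x ∈ subrepresentationOfStable ρ (carried ρ S U) (carried_stable ρ S U hU) := by
      rw [h]; trivial
    exact (mem_subrepresentationOfStable ρ _ _ x).mp hx'

omit [IsAlgClosed k] [Module.Finite k V] [ρ.IsIrreducible] [IsSimpleModule k[G₁] S] in
/-- `S ⊗ U → S ⊗ Mult` is injective (flatness over the field `k`). -/
theorem injective_lTensor_subtype (U : Submodule k (Mult ρ S)) :
    Function.Injective (U.subtype.lTensor S) :=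
  Module.Flat.lTensor_preserves_injective_linearMap U.subtype Subtype.val_injective

omit [IsAlgClosed k] [ρ.IsIrreducible] in
/-- `0 < finrank k S`. -/
theorem finrank_pos_S : 0 < Module.finrank k S := by
  haveI := finite_submodule ρ S
  haveI : Nontrivial S := IsSimpleModule.nontrivial k[G₁] S
  exact Module.finrank_pos

/-- If `carried U = ⊥` then `U = ⊥`. -/
theorem eq_bot_of_carried_eq_bot (U : Submodule k (Mult ρ S)) (h : carried ρ S U = ⊥) :
    U = ⊥ := by
  haveI := finite_submodule ρ S
  haveI := finite_mult ρ S
  -- every element of `S ⊗ U` maps to `0`, hence is `0`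
  have hz : ∀ z : S ⊗[k] U, z = 0 := by
    intro z
    have hmem : multTensorEquiv ρ S (TensorProduct.AlgebraTensorModule.map
        (LinearMap.id : S →ₗ[k[G₁]] S) U.subtype z) ∈ carried ρ S U := ⟨_, ⟨z, rfl⟩, rfl⟩
    rw [h, Submodule.mem_bot] at hmem
    have h0 : TensorProduct.AlgebraTensorModule.map (LinearMap.id : S →ₗ[k[G₁]] S) U.subtype z
        = 0 := (multTensorEquiv ρ S).map_eq_zero_iff.mp hmem
    rw [algebraTensorModule_map_eq] at h0
    exact injective_lTensor_subtype ρ S U (h0.trans (map_zero _).symm)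
  haveI : Subsingleton (S ⊗[k] U) := ⟨fun a b => (hz a).trans (hz b).symm⟩
  haveI : Module.Free k U := Module.Free.of_divisionRing k U
  haveI : Module.Free k S := Module.Free.of_divisionRing k S
  have hfin : Module.finrank k (S ⊗[k] U) = 0 := Module.finrank_zero_of_subsingleton
  rw [Module.finrank_tensorProduct] at hfin
  rcases Nat.mul_eq_zero.mp hfin with h1 | h1
  · exact absurd h1 (finrank_pos_S ρ S).ne'
  · exact Submodule.finrank_eq_zero.mp h1

/-- If `carried U = ⊤` then `U = ⊤`. -/
theorem eq_top_of_carried_eq_top (U : Submodule k (Mult ρ S)) (h : carried ρ S U = ⊤) :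
    U = ⊤ := by
  haveI := finite_submodule ρ S
  haveI := finite_mult ρ S
  -- `lTensor S U.subtype` is surjective
  have hsurj : Function.Surjective (U.subtype.lTensor S) := by
    intro y
    have hy : multTensorEquiv ρ S y ∈ carried ρ S U := by rw [h]; trivial
    obtain ⟨y', ⟨z, hz⟩, hy'⟩ := hy
    refine ⟨z, ?_⟩
    rw [← algebraTensorModule_map_eq, hz]
    exact (multTensorEquiv ρ S).injective hy'
  haveI : Module.Free k U := Module.Free.of_divisionRing k U
  haveI : Module.Free k S := Module.Free.of_divisionRing k S
  haveI : Module.Free k (Mult ρ S) := Module.Free.of_divisionRing k (Mult ρ S)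
  have hle := LinearMap.finrank_le_finrank_of_surjective hsurj
  rw [Module.finrank_tensorProduct, Module.finrank_tensorProduct] at hle
  have hle' : Module.finrank k (Mult ρ S) ≤ Module.finrank k U :=
    Nat.le_of_mul_le_mul_left hle (finrank_pos_S ρ S)
  exact Submodule.eq_top_of_finrank_eq (le_antisymm (Submodule.finrank_le U) hle')

omit [IsAlgClosed k] [Module.Finite k V] [ρ.IsIrreducible] in
/-- The multiplicity space is non-zero: the inclusion `S ↪ V` is a non-zero element. -/
theorem nontrivial_mult : Nontrivial (Mult ρ S) := by
  haveI : Nontrivial S := IsSimpleModule.nontrivial k[G₁] S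
  obtain ⟨x, hx⟩ := exists_ne (0 : S)
  refine ⟨⟨S.subtype, 0, fun h => hx ?_⟩⟩
  have := congrArg (fun f : Mult ρ S => f x) h
  simpa only [Submodule.subtype_apply, LinearMap.zero_apply, ZeroMemClass.coe_eq_zero] using this

/-- THE MULTIPLICITY REPRESENTATION IS IRREDUCIBLE. -/
theorem mult_isIrreducible : (mult ρ S).IsIrreducible := by
  haveI := nontrivial_mult ρ S
  haveI : Nontrivial (Submodule k (Mult ρ S)) := (Submodule.nontrivial_iff k).mpr inferInstance
  refine { exists_pair_ne := ⟨⊥, ⊤, fun h => ?_⟩, eq_bot_or_eq_top := fun U => ?_ }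
  · have h' : ((⊥ : Subrepresentation (mult ρ S)).toSubmodule : Submodule k (Mult ρ S)) =
        (⊤ : Subrepresentation (mult ρ S)).toSubmodule := by rw [h]
    exact bot_ne_top h'
  · have hU : ∀ g₂ : G₂, ∀ f ∈ U.toSubmodule, mult ρ S g₂ f ∈ U.toSubmodule :=
      fun g₂ f hf => U.apply_mem_toSubmodule g₂ hf
    rcases carried_eq_bot_or_eq_top ρ S U.toSubmodule hU with h | h
    · left
      exact Subrepresentation.toSubmodule_injective (eq_bot_of_carried_eq_bot ρ S _ h)
    · right
      exact Subrepresentation.toSubmodule_injective (eq_top_of_carried_eq_top ρ S _ h)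

end Irreducible

end Summit.Ventures.HodgeRepro2.T5ProductTensor
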